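import Summits.QuantumFields.BalabanUV.T4Continuum.Support.NE7CornerBumpFlatProjection
import HarnessLib

/-!
# NE7CornerBumpFlatGalerkin — THE GALERKIN PROJECTION OF THE BUMP CLASS AT THE FLAT BACKGROUND EXISTS: for every linear functional `ℓ` there is `λ ∈ T^ρ` with
# `Σ hsR (Δ_1λ)(Δ_1ν) = ℓ(ν)` on `T^ρ` (Riesz; `Δ_1` is injective on `T^ρ`); hence F90's letter `hGal` (every `Y` has `λ₁` with `Y + D_1λ₁` Landau against `T^ρ`)
# and the existence half of `hGalR` (every `F` has `λ₁ ∈ T^ρ` with `F + Δ_1λ₁ ⊥ Δ_1T^ρ`) at `W = 1`; file 31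

Cell `pub-balaban`, rung (B)+1 sub-cell t4, lineage `b2b-balaban-t4-ne7-p1` (CRUX PROVER NE7 #1 = OWNER of row NE7), generation 78; memo
`t4/b2b-balaban-t4-ne7-p1-g78/BUMP-CLASS-FLAT.md` §4.  File F100 (over F97 `NE7CornerBumpFlatProjection`'s helpers and the Riesz pattern of row NE3's
`LandauProjectionB8.exists_landauB8_correction`: `LinearMap.BilinForm.toDual` on a finite-dimensional real space).
WHY (memo §4).  F90 needs, besides the LHCI (F96∕F98), the GALERKIN letters of the test class: a generator `λ₁` with `Y + D_Wλ₁` Landau against `T` (`hGal`) and, for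
site sources `F`, a `λ₁` with `F + Δ_Wλ₁ ⊥ Δ_W T` plus two sup bounds (`hGalR`).  For B8's class these are row NE3's theorems; for the bump class `T^ρ` THIS FILE gives
the existence halves at `W = 1` by the Riesz vector of `ℓ` for the Gram form `(λ, ν) ↦ Σ hsR (Δ_1λ)(Δ_1ν)` on the finite-dimensional real space
`S = {skew, (N·M)-periodic, T^ρ}` — nondegenerate because `Δ_1ν = 0` forces `ν` constant (F97's rigidity) and clause (ii) (the smeared mean at the corner `0`,
`Σρ > 0`) forces the constant to vanish.  The sup bounds of `hGalR` are file 32 (F97's projection + F99's Gram constant).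
WHAT ([folklore]; 0 def, 0 sorry; class by the equational hypothesis `hT` as in F96–F98).  §1 `eq_zero_of_mem_bump_of_covLapSite_eq_zero` (injectivity of `Δ_1` on
`T^ρ`); §2 **`exists_riesz_flatCfg_bump`** (the Riesz vector for an arbitrary additive-homogeneous `ℓ`); §3 **`galerkin_dir_flatCfg_bump`** (F90's `hGal` at `W = 1`),
**`galerkin_site_flatCfg_bump`** (the existence half of `hGalR`, with `λ₁ ∈ T^ρ`).
HONEST FRAMING (page 1): finite-dimensional linear algebra at the TRIVIAL background; the sup bounds, the curved letters, (L1)′, α₁, (L2) are NOT here; nothing of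
Bałaban's asserted; (APE) NOT proved; NOT ONE-STEP, NOT NE7; spine 0∕9; finite T⁴ rung (B)+1 — NOT infinite volume, NOT mass gap, NOT `BetaPertH`, NOT Clay.
Continuum YM on T⁴ ⇐ BetaPertH ∧ nine spine estimates (0/9 proved); BetaPertH ⇐ (D1) ∧ (D4) ∧ CAP+tail; G-an2-4 gates asym, D1 and NE2/3/4.
-/

set_option autoImplicit false

open scoped BigOperators Matrix Matrix.Norms.L2Operator
open NormedSpace Finset

namespace Summit.QuantumFields.BalabanUV.T4Continuum.NE7CornerBumpFlatGalerkin

open Literature.MathematicalPhysics.QuantumFieldTheory.Balaban1983to89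
open B7Prop1Explicit B7Prop2Explicit MatrixNorms
open T4AveragingDeficitWall (IsUnitaryCfg)
open T4AveragingDeficitWallBoundary (IsPeriodicCfg periodBox mem_periodBox)
open MinimalActionWitness (flatCfg isPeriodicCfg_flatCfg)
open BlockAveragePushDirGauge (gaugeDir)
open SmoothRefineBlocks (blk res)
open NE3CovariantCalculus (hsR hsR_self hsR_add_left hsR_add_right hsR_sum_left)
open NE3FrameFreeDecompositionPrep (hsR_smul_left hsR_smul_right)
open NE3LandauOrbit (hsR_zero_left hsR_zero_right eq_zero_of_nhsNormSq_eq_zero)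
open NE3CurvedCornerGaugeSpace (gaugeDir_add_pi gaugeDir_smul_pi)
open NE3FlatHessianCurl (isUnitaryCfg_flatCfg)
open NE3.PairLandauB8 (covLapSite)
open NE3.LandauProjectionB8 (covLapSite_add covLapSite_smul covLapSite_add_period sum_hsR_gaugeDir_gaugeDir_covLapSite)
open PeriodicChoice (apply_wrap_eq wrap_mem_periodBox periodic_vec)
open NE7ProfileFieldFlat (sum_hsR_profS)
open NE7CornerBumpFlatLHCI (rho_nonneg rho_mid_pos)
open NE7CornerBumpFlatProjection (eq_zero_of_mem_periodBox_of_dvd dvd_add_period_iff sum_rho_pos const_of_covLapSite_flatCfg_eq_zero)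

noncomputable section

variable {d : ℕ} {n : Type*} [Fintype n] [DecidableEq n]

/-! ## §1 `Δ_1` is injective on the bump class -/

/-- **`Δ_1` IS INJECTIVE ON THE BUMP CLASS**: a skew `(N·M)`-periodic `ν` satisfying clause (ii) (the smeared mean at the corner `0` vanishes) with `Δ_1ν = 0`
on the period box is zero — `ν` is constant by F97's rigidity and `(Σρ)·‖ν(0)‖² = 0`. [folklore] -/
theorem eq_zero_of_mem_bump_of_covLapSite_eq_zero {M N : ℕ} (hM : 8 ≤ M) (hN : 1 ≤ N) {ψ : ℤ → ℝ}
    (hψ : ∀ t : ℤ, ψ t = if 2 ≤ t ∧ t ≤ (M : ℤ) - 2 then (((t : ℝ) - 2) * ((M : ℝ) - 2 - t)) ^ 2 else 0)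
    {ρ : Site d → ℝ} (hρ : ∀ r, ρ r = ∏ i, ψ (r i)) (s : Site d)
    {nu : Site d → Matrix n n ℂ} (hnus : ∀ y, nu y ∈ skewAdjoint (Matrix n n ℂ))
    (hnuP : ∀ (y : Site d) (i : Fin d), nu (y + ((N * M : ℕ) : ℤ) • e i) = nu y)
    (hii : ∀ C : Site d → Matrix n n ℂ, (∀ w, C w ∈ skewAdjoint (Matrix n n ℂ)) → (∀ (w : Site d) (i : Fin d), C (w + (N : ℤ) • e i) = C w) →
          (∀ w : Site d, (¬ ∀ i, (N : ℤ) ∣ w i) → C w = 0) →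
          ∑ y ∈ periodBox (d := d) (N * M), hsR ((fun x => ρ (res M (x + s)) • C (blk M (x + s))) y) (nu y) = 0)
    (h0 : ∀ y ∈ periodBox (d := d) (N * M), covLapSite (flatCfg (d := d) (n := n)) nu y = 0) : nu = 0 := by
  classical
  have hM1 : 1 ≤ M := by omega
  have hP : 1 ≤ N * M := Nat.mul_pos (by omega) (by omega)
  have hWP : IsPeriodicCfg (flatCfg (d := d) (n := n)) ((N * M : ℕ) : ℤ) := isPeriodicCfg_flatCfg _
  -- `Δν = 0` everywhere, so `ν` is constant
  have hΔP := covLapSite_add_period hWP hnuP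
  have hall : ∀ y, covLapSite (flatCfg (d := d) (n := n)) nu y = 0 := fun y => by
    rw [← apply_wrap_eq hΔP y]; exact h0 _ (wrap_mem_periodBox (N * M) hP y)
  have hconst : ∀ v, nu v = nu 0 := const_of_covLapSite_flatCfg_eq_zero hP hnuP hall
  -- clause (ii) with the datum `[class 0]·ν(0)` gives `(Σρ)·‖ν 0‖² = 0`
  set X : Matrix n n ℂ := nu 0 with hX
  set C : Site d → Matrix n n ℂ := fun w => if (∀ i, (N : ℤ) ∣ w i) then X else 0 with hC
  have hCs : ∀ w, C w ∈ skewAdjoint (Matrix n n ℂ) := fun w => by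
    simp only [hC]; split_ifs
    · exact hnus 0
    · exact (skewAdjoint _).zero_mem
  have hCP : ∀ (w : Site d) (i : Fin d), C (w + (N : ℤ) • e i) = C w := fun w i => by simp only [hC, dvd_add_period_iff w i]
  have hC0 : ∀ w : Site d, (¬ ∀ i, (N : ℤ) ∣ w i) → C w = 0 := fun w hw => by simp only [hC, if_neg hw]
  have h1 := hii C hCs hCP hC0
  have e := sum_hsR_profS hM1 hN s ρ C hnuP hCP
  simp only at e
  rw [e] at h1
  have hin : ∀ w ∈ periodBox (d := d) N, hsR (C w) (∑ r ∈ periodBox (d := d) M, ρ r • nu ((M : ℤ) • w + r - s))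
      = if w = 0 then (∑ r ∈ periodBox (d := d) M, ρ r) * nhsNormSq X else 0 := by
    intro w hw
    split_ifs with hw0
    · subst hw0
      rw [Finset.sum_congr rfl fun r _ => by rw [hconst ((M : ℤ) • (0 : Site d) + r - s)], ← Finset.sum_smul, hsR_smul_right]
      simp only [hC]; rw [if_pos fun i => by simp, hsR_self]
    · have hw' : ¬ ∀ i, (N : ℤ) ∣ w i := fun hd => hw0 (eq_zero_of_mem_periodBox_of_dvd hw hd)
      rw [hC0 w hw', hsR_zero_left]
  rw [Finset.sum_congr rfl hin, Finset.sum_ite_eq' (periodBox (d := d) N) (0 : Site d), if_pos] at h1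
  swap
  · exact mem_periodBox.mpr fun _ => ⟨le_rfl, by simp only [Pi.zero_apply]; exact_mod_cast (by omega : 0 < N)⟩
  rcases mul_eq_zero.mp h1 with h2 | h2
  · exact absurd h2 (sum_rho_pos hM hψ hρ).ne'
  · have hX0 : X = 0 := eq_zero_of_nhsNormSq_eq_zero h2
    funext v; rw [hconst v]; exact hX0

/-! ## §2 The Riesz vector for the Gram form of `Δ_1` on the bump class -/

/-- **THE RIESZ VECTOR**: for every additive, real-homogeneous functional `ℓ` on site fields there is `λ` in the bump class (skew, periodic, `T^ρ`) with
`Σ_y hsR (Δ_1λ y)(Δ_1ν y) = ℓ ν` for all skew periodic `ν ∈ T^ρ` (`M ≥ 8`, `N ≥ 1`). [folklore] -/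
theorem exists_riesz_flatCfg_bump {M N : ℕ} (hM : 8 ≤ M) (hN : 1 ≤ N) {ψ : ℤ → ℝ}
    (hψ : ∀ t : ℤ, ψ t = if 2 ≤ t ∧ t ≤ (M : ℤ) - 2 then (((t : ℝ) - 2) * ((M : ℝ) - 2 - t)) ^ 2 else 0)
    {ρ : Site d → ℝ} (hρ : ∀ r, ρ r = ∏ i, ψ (r i)) (s : Site d)
    (T : (Site d → Matrix n n ℂ) → Prop)
    (hT : ∀ nu : Site d → Matrix n n ℂ, T nu ↔
      ((∀ C : Site d → Matrix n n ℂ, (∀ w, C w ∈ skewAdjoint (Matrix n n ℂ)) → (∀ (w : Site d) (i : Fin d), C (w + (N : ℤ) • e i) = C w) →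
          (∀ w : Site d, C ((N : ℤ) • w) = 0) →
          ∑ y ∈ periodBox (d := d) (N * M), hsR ((fun x => ρ (res M (x + s)) • C (blk M (x + s))) y)
            (covLapSite (flatCfg (d := d) (n := n)) (covLapSite (flatCfg (d := d) (n := n)) nu) y) = 0) ∧
       (∀ C : Site d → Matrix n n ℂ, (∀ w, C w ∈ skewAdjoint (Matrix n n ℂ)) → (∀ (w : Site d) (i : Fin d), C (w + (N : ℤ) • e i) = C w) →
          (∀ w : Site d, (¬ ∀ i, (N : ℤ) ∣ w i) → C w = 0) →
          ∑ y ∈ periodBox (d := d) (N * M), hsR ((fun x => ρ (res M (x + s)) • C (blk M (x + s))) y) (nu y) = 0)))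
    (ℓ : (Site d → Matrix n n ℂ) → ℝ) (hℓadd : ∀ f g : Site d → Matrix n n ℂ, ℓ (f + g) = ℓ f + ℓ g)
    (hℓsmul : ∀ (t : ℝ) (f : Site d → Matrix n n ℂ), ℓ (t • f) = t * ℓ f) :
    ∃ lam : Site d → Matrix n n ℂ,
      (∀ y, lam y ∈ skewAdjoint (Matrix n n ℂ)) ∧ (∀ (y : Site d) (i : Fin d), lam (y + ((N * M : ℕ) : ℤ) • e i) = lam y) ∧ T lam ∧
      ∀ nu : Site d → Matrix n n ℂ, (∀ y, nu y ∈ skewAdjoint (Matrix n n ℂ)) →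
          (∀ (y : Site d) (i : Fin d), nu (y + ((N * M : ℕ) : ℤ) • e i) = nu y) → T nu →
        ∑ y ∈ periodBox (d := d) (N * M), hsR (covLapSite (flatCfg (d := d) (n := n)) lam y) (covLapSite (flatCfg (d := d) (n := n)) nu y) = ℓ nu := by
  have hP : 1 ≤ N * M := Nat.mul_pos (by omega) (by omega)
  set W1 := (flatCfg (d := d) (n := n)) with hW1
  -- linearity of the two clauses
  have hΔadd : ∀ f g : Site d → Matrix n n ℂ, covLapSite W1 (covLapSite W1 (f + g)) = covLapSite W1 (covLapSite W1 f) + covLapSite W1 (covLapSite W1 g) :=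
    fun f g => by rw [covLapSite_add, covLapSite_add]
  have hΔsmul : ∀ (t : ℝ) (f : Site d → Matrix n n ℂ), covLapSite W1 (covLapSite W1 (t • f)) = t • covLapSite W1 (covLapSite W1 f) :=
    fun t f => by rw [covLapSite_smul, covLapSite_smul]
  -- the class as a real submodule
  let S : Submodule ℝ (Site d → Matrix n n ℂ) :=
    { carrier := {mu | (∀ y, mu y ∈ skewAdjoint (Matrix n n ℂ)) ∧ (∀ (y : Site d) (i : Fin d), mu (y + ((N * M : ℕ) : ℤ) • e i) = mu y) ∧ T mu}
      zero_mem' := by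
        refine ⟨fun _ => (skewAdjoint _).zero_mem, fun _ _ => rfl, (hT 0).mpr ⟨fun C _ _ _ => ?_, fun C _ _ _ => ?_⟩⟩
        · have hz : covLapSite W1 (covLapSite W1 (0 : Site d → Matrix n n ℂ)) = 0 := by
            have := hΔsmul 0 0; simp only [zero_smul] at this; exact this
          exact Finset.sum_eq_zero fun y _ => by rw [hz, Pi.zero_apply, hsR_zero_right]
        · exact Finset.sum_eq_zero fun y _ => by rw [Pi.zero_apply, hsR_zero_right]
      add_mem' := by
        rintro mu nu ⟨hμs, hμP, hμT⟩ ⟨hνs, hνP, hνT⟩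
        obtain ⟨hμ1, hμ2⟩ := (hT mu).mp hμT
        obtain ⟨hν1, hν2⟩ := (hT nu).mp hνT
        refine ⟨fun y => (skewAdjoint _).add_mem (hμs y) (hνs y), fun y i => by simp only [Pi.add_apply, hμP, hνP],
          (hT _).mpr ⟨fun C hCs hCP hC0 => ?_, fun C hCs hCP hC0 => ?_⟩⟩
        · rw [hΔadd]; simp only [Pi.add_apply, hsR_add_right, Finset.sum_add_distrib, hμ1 C hCs hCP hC0, hν1 C hCs hCP hC0, add_zero]
        · simp only [Pi.add_apply, hsR_add_right, Finset.sum_add_distrib, hμ2 C hCs hCP hC0, hν2 C hCs hCP hC0, add_zero]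
      smul_mem' := by
        rintro t mu ⟨hμs, hμP, hμT⟩
        obtain ⟨hμ1, hμ2⟩ := (hT mu).mp hμT
        refine ⟨fun y => skewAdjoint.smul_mem t (hμs y), fun y i => by simp only [Pi.smul_apply, hμP],
          (hT _).mpr ⟨fun C hCs hCP hC0 => ?_, fun C hCs hCP hC0 => ?_⟩⟩
        · rw [hΔsmul]; simp only [Pi.smul_apply, hsR_smul_right, ← Finset.mul_sum, hμ1 C hCs hCP hC0, mul_zero]
        · simp only [Pi.smul_apply, hsR_smul_right, ← Finset.mul_sum, hμ2 C hCs hCP hC0, mul_zero] }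
  have hSmem : ∀ {mu : Site d → Matrix n n ℂ}, mu ∈ S ↔
      ((∀ y, mu y ∈ skewAdjoint (Matrix n n ℂ)) ∧ (∀ (y : Site d) (i : Fin d), mu (y + ((N * M : ℕ) : ℤ) • e i) = mu y) ∧ T mu) := fun {mu} => Iff.rfl
  -- finite-dimensional: restriction to the period box is injective
  haveI : FiniteDimensional ℝ S := by
    let resb : S →ₗ[ℝ] (↥(periodBox (d := d) (N * M)) → Matrix n n ℂ) :=
      { toFun := fun ξ y => (ξ : Site d → Matrix n n ℂ) y.1
        map_add' := fun _ _ => rfl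
        map_smul' := fun _ _ => rfl }
    refine FiniteDimensional.of_injective resb fun ξ ζ h => ?_
    apply Subtype.ext
    funext y
    have hξ := apply_wrap_eq (hSmem.mp ξ.2).2.1 y
    have hζ := apply_wrap_eq (hSmem.mp ζ.2).2.1 y
    rw [← hξ, ← hζ]
    exact congr_fun h ⟨_, wrap_mem_periodBox (N * M) hP y⟩
  -- the Gram form of `Δ_1`
  let G : LinearMap.BilinForm ℝ S :=
    LinearMap.mk₂ ℝ
      (fun lam nu => ∑ y ∈ periodBox (d := d) (N * M),
        hsR (covLapSite W1 (lam : Site d → Matrix n n ℂ) y) (covLapSite W1 (nu : Site d → Matrix n n ℂ) y))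
      (fun lam lam' nu => by
        simp only [Submodule.coe_add, covLapSite_add, Pi.add_apply, hsR_add_left, Finset.sum_add_distrib])
      (fun t lam nu => by
        simp only [Submodule.coe_smul, covLapSite_smul, Pi.smul_apply, hsR_smul_left, Finset.mul_sum, smul_eq_mul])
      (fun lam nu nu' => by
        simp only [Submodule.coe_add, covLapSite_add, Pi.add_apply, hsR_add_right, Finset.sum_add_distrib])
      (fun t lam nu => by
        simp only [Submodule.coe_smul, covLapSite_smul, Pi.smul_apply, hsR_smul_right, Finset.mul_sum, smul_eq_mul])
  have hG : ∀ lam nu : S, G lam nu = ∑ y ∈ periodBox (d := d) (N * M),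
      hsR (covLapSite W1 (lam : Site d → Matrix n n ℂ) y) (covLapSite W1 (nu : Site d → Matrix n n ℂ) y) := fun _ _ => rfl
  -- nondegeneracy
  have key : ∀ lam : S, G lam lam = 0 → lam = 0 := by
    intro lam h
    obtain ⟨hls, hlP, hlT⟩ := hSmem.mp lam.2
    rw [hG] at h
    simp only [hsR_self] at h
    have hbox : ∀ y ∈ periodBox (d := d) (N * M), covLapSite W1 (lam : Site d → Matrix n n ℂ) y = 0 := fun y hy =>
      eq_zero_of_nhsNormSq_eq_zero ((Finset.sum_eq_zero_iff_of_nonneg fun y' _ =>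
        nhsNormSq_nonneg (covLapSite W1 (lam : Site d → Matrix n n ℂ) y')).1 h y hy)
    exact Subtype.ext (eq_zero_of_mem_bump_of_covLapSite_eq_zero hM hN hψ hρ s hls hlP ((hT _).mp hlT).2 hbox)
  have hGnd : G.Nondegenerate := ⟨fun lam hlam => key lam (hlam lam), fun lam hlam => key lam (hlam lam)⟩
  -- the functional and its Riesz vector
  let L : Module.Dual ℝ S :=
    { toFun := fun nu => ℓ (nu : Site d → Matrix n n ℂ)
      map_add' := fun nu nu' => by simp only [Submodule.coe_add, hℓadd]
      map_smul' := fun t nu => by simp only [Submodule.coe_smul, hℓsmul, RingHom.id_apply, smul_eq_mul] }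
  set lam := (G.toDual hGnd).symm L with hlam_def
  obtain ⟨hls, hlP, hlT⟩ := hSmem.mp lam.2
  refine ⟨lam, hls, hlP, hlT, fun nu hnus hnuP hnuT => ?_⟩
  have h := LinearMap.BilinForm.apply_toDual_symm_apply (hB := hGnd) L ⟨nu, hSmem.mpr ⟨hnus, hnuP, hnuT⟩⟩
  rw [← hlam_def, hG] at h
  exact h

/-! ## §3 F90's `hGal` and the existence half of `hGalR` for the bump class at the flat background -/

/-- **F90's `hGal` AT `W = 1` FOR THE BUMP CLASS**: every direction field `Y` has `λ₁` (skew, periodic, in `T^ρ`) with `Y + D_1λ₁` Landau against `T^ρ`. [folklore] -/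
theorem galerkin_dir_flatCfg_bump {M N : ℕ} (hM : 8 ≤ M) (hN : 1 ≤ N) {ψ : ℤ → ℝ}
    (hψ : ∀ t : ℤ, ψ t = if 2 ≤ t ∧ t ≤ (M : ℤ) - 2 then (((t : ℝ) - 2) * ((M : ℝ) - 2 - t)) ^ 2 else 0)
    {ρ : Site d → ℝ} (hρ : ∀ r, ρ r = ∏ i, ψ (r i)) (s : Site d)
    (T : (Site d → Matrix n n ℂ) → Prop)
    (hT : ∀ nu : Site d → Matrix n n ℂ, T nu ↔
      ((∀ C : Site d → Matrix n n ℂ, (∀ w, C w ∈ skewAdjoint (Matrix n n ℂ)) → (∀ (w : Site d) (i : Fin d), C (w + (N : ℤ) • e i) = C w) →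
          (∀ w : Site d, C ((N : ℤ) • w) = 0) →
          ∑ y ∈ periodBox (d := d) (N * M), hsR ((fun x => ρ (res M (x + s)) • C (blk M (x + s))) y)
            (covLapSite (flatCfg (d := d) (n := n)) (covLapSite (flatCfg (d := d) (n := n)) nu) y) = 0) ∧
       (∀ C : Site d → Matrix n n ℂ, (∀ w, C w ∈ skewAdjoint (Matrix n n ℂ)) → (∀ (w : Site d) (i : Fin d), C (w + (N : ℤ) • e i) = C w) →
          (∀ w : Site d, (¬ ∀ i, (N : ℤ) ∣ w i) → C w = 0) →
          ∑ y ∈ periodBox (d := d) (N * M), hsR ((fun x => ρ (res M (x + s)) • C (blk M (x + s))) y) (nu y) = 0))) :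
    ∀ Y : Site d → Fin d → Matrix n n ℂ, ∃ lam₁ : Site d → Matrix n n ℂ,
      (∀ y, lam₁ y ∈ skewAdjoint (Matrix n n ℂ)) ∧ (∀ (y : Site d) (i : Fin d), lam₁ (y + ((N * M : ℕ) : ℤ) • e i) = lam₁ y) ∧ T lam₁ ∧
      (∀ nu : Site d → Matrix n n ℂ, (∀ y, nu y ∈ skewAdjoint (Matrix n n ℂ)) →
          (∀ (y : Site d) (i : Fin d), nu (y + ((N * M : ℕ) : ℤ) • e i) = nu y) → T nu →
        ∑ y ∈ periodBox (d := d) (N * M), ∑ κ : Fin d,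
          hsR (Y y κ + gaugeDir (flatCfg (d := d) (n := n)) lam₁ y κ) (gaugeDir (flatCfg (d := d) (n := n)) (covLapSite (flatCfg (d := d) (n := n)) nu) y κ) = 0) := by
  intro Y
  have hP : 1 ≤ N * M := Nat.mul_pos (by omega) (by omega)
  have hWu : IsUnitaryCfg (flatCfg (d := d) (n := n)) := isUnitaryCfg_flatCfg
  have hWP : IsPeriodicCfg (flatCfg (d := d) (n := n)) ((N * M : ℕ) : ℤ) := isPeriodicCfg_flatCfg _
  set ℓ : (Site d → Matrix n n ℂ) → ℝ := fun nu => -∑ y ∈ periodBox (d := d) (N * M), ∑ κ : Fin d,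
    hsR (Y y κ) (gaugeDir (flatCfg (d := d) (n := n)) (covLapSite (flatCfg (d := d) (n := n)) nu) y κ) with hℓ
  have hℓadd : ∀ f g : Site d → Matrix n n ℂ, ℓ (f + g) = ℓ f + ℓ g := fun f g => by
    simp only [hℓ, covLapSite_add, gaugeDir_add_pi, hsR_add_right, Finset.sum_add_distrib, neg_add]
  have hℓsmul : ∀ (t : ℝ) (f : Site d → Matrix n n ℂ), ℓ (t • f) = t * ℓ f := fun t f => by
    simp only [hℓ, covLapSite_smul, gaugeDir_smul_pi, hsR_smul_right, ← Finset.mul_sum, mul_neg]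
  obtain ⟨lam, hls, hlP, hlT, hriesz⟩ := exists_riesz_flatCfg_bump hM hN hψ hρ s T hT ℓ hℓadd hℓsmul
  refine ⟨lam, hls, hlP, hlT, fun nu hnus hnuP hnuT => ?_⟩
  have h := hriesz nu hnus hnuP hnuT
  rw [← sum_hsR_gaugeDir_gaugeDir_covLapSite hP hWu hWP hlP hnuP] at h
  simp only [hsR_add_left, Finset.sum_add_distrib]
  rw [h, hℓ]
  simp only [add_neg_cancel]

/-- **THE EXISTENCE HALF OF F90's `hGalR` AT `W = 1` FOR THE BUMP CLASS**: every site source `F` has `λ₁` (skew, periodic, IN `T^ρ`) with `F + Δ_1λ₁ ⊥ Δ_1T^ρ`.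
[folklore] -/
theorem galerkin_site_flatCfg_bump {M N : ℕ} (hM : 8 ≤ M) (hN : 1 ≤ N) {ψ : ℤ → ℝ}
    (hψ : ∀ t : ℤ, ψ t = if 2 ≤ t ∧ t ≤ (M : ℤ) - 2 then (((t : ℝ) - 2) * ((M : ℝ) - 2 - t)) ^ 2 else 0)
    {ρ : Site d → ℝ} (hρ : ∀ r, ρ r = ∏ i, ψ (r i)) (s : Site d)
    (T : (Site d → Matrix n n ℂ) → Prop)
    (hT : ∀ nu : Site d → Matrix n n ℂ, T nu ↔
      ((∀ C : Site d → Matrix n n ℂ, (∀ w, C w ∈ skewAdjoint (Matrix n n ℂ)) → (∀ (w : Site d) (i : Fin d), C (w + (N : ℤ) • e i) = C w) →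
          (∀ w : Site d, C ((N : ℤ) • w) = 0) →
          ∑ y ∈ periodBox (d := d) (N * M), hsR ((fun x => ρ (res M (x + s)) • C (blk M (x + s))) y)
            (covLapSite (flatCfg (d := d) (n := n)) (covLapSite (flatCfg (d := d) (n := n)) nu) y) = 0) ∧
       (∀ C : Site d → Matrix n n ℂ, (∀ w, C w ∈ skewAdjoint (Matrix n n ℂ)) → (∀ (w : Site d) (i : Fin d), C (w + (N : ℤ) • e i) = C w) →
          (∀ w : Site d, (¬ ∀ i, (N : ℤ) ∣ w i) → C w = 0) →
          ∑ y ∈ periodBox (d := d) (N * M), hsR ((fun x => ρ (res M (x + s)) • C (blk M (x + s))) y) (nu y) = 0)))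
    (F : Site d → Matrix n n ℂ) : ∃ lam₁ : Site d → Matrix n n ℂ,
      (∀ y, lam₁ y ∈ skewAdjoint (Matrix n n ℂ)) ∧ (∀ (y : Site d) (i : Fin d), lam₁ (y + ((N * M : ℕ) : ℤ) • e i) = lam₁ y) ∧ T lam₁ ∧
      (∀ nu : Site d → Matrix n n ℂ, (∀ y, nu y ∈ skewAdjoint (Matrix n n ℂ)) →
          (∀ (y : Site d) (i : Fin d), nu (y + ((N * M : ℕ) : ℤ) • e i) = nu y) → T nu →
        ∑ y ∈ periodBox (d := d) (N * M), hsR (F y + covLapSite (flatCfg (d := d) (n := n)) lam₁ y) (covLapSite (flatCfg (d := d) (n := n)) nu y) = 0) := by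
  set ℓ : (Site d → Matrix n n ℂ) → ℝ := fun nu => -∑ y ∈ periodBox (d := d) (N * M),
    hsR (F y) (covLapSite (flatCfg (d := d) (n := n)) nu y) with hℓ
  have hℓadd : ∀ f g : Site d → Matrix n n ℂ, ℓ (f + g) = ℓ f + ℓ g := fun f g => by
    simp only [hℓ, covLapSite_add, Pi.add_apply, hsR_add_right, Finset.sum_add_distrib, neg_add]
  have hℓsmul : ∀ (t : ℝ) (f : Site d → Matrix n n ℂ), ℓ (t • f) = t * ℓ f := fun t f => by
    simp only [hℓ, covLapSite_smul, Pi.smul_apply, hsR_smul_right, ← Finset.mul_sum, mul_neg]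
  obtain ⟨lam, hls, hlP, hlT, hriesz⟩ := exists_riesz_flatCfg_bump hM hN hψ hρ s T hT ℓ hℓadd hℓsmul
  refine ⟨lam, hls, hlP, hlT, fun nu hnus hnuP hnuT => ?_⟩
  have h := hriesz nu hnus hnuP hnuT
  simp only [hsR_add_left, Finset.sum_add_distrib]
  rw [h, hℓ]
  simp only [add_neg_cancel]

end

end Summit.QuantumFields.BalabanUV.T4Continuum.NE7CornerBumpFlatGalerkin
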